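import Mathlib
import Literature.AlgebraicGeometry.HyperbolicPolynomials.Garding
import Literature.AlgebraicGeometry.HyperbolicPolynomials.LineDerivatives
import HarnessLib

/-!
# Smooth boundary points of hyperbolicity cones (Netzer–Sanyal, §2)

Topic `Literature/AlgebraicGeometry/HyperbolicPolynomials`; a step towards Netzer–Sanyal 2015,
Thm 1.1 (`SpectrahedralShadow.lean`, fact `NetzerSanyal2014_thm11`): the differential facts about
a form `f` hyperbolic w.r.t. `e` at points of its closed cone `Λ₊ = hyperbolicityCone f e` that
the proof of Thm 1.1 (via Thm 3.1 and Lemma 2.4 of loc. cit.) uses. Everything is PROVED; no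
named facts. Derivatives are handled algebraically through the line polynomial
`linePoly f x v = (t ↦ f(x + tv))` (`LineDerivatives.lean`: `coeff 1 = ⟨∇f(x), v⟩`,
`2 coeff 2 = vᵀ∇²f(x)v`).

## Main results (namespace `Literature.AlgebraicGeometry.HyperbolicPolynomials`)

* `gradForm f x` — the linear form `v ↦ ⟨∇f(x), v⟩ = coeff 1 (linePoly f x v)`.
* `coeff_one_linePoly_dir_pos` / `_ne_zero` — **transversality** (N–S Remark 2.2 (ii) with
  Lemma 2.1, for points of the cone; Renegar 2006): at `a ∈ Λ₊` with `f(a) = 0` and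
  `∇f(a) ≠ 0`, `∂ₑ f(a) ≠ 0` (with the sign of `f(e)`). Proved from the convexity of `Λ₊`
  (`Garding.lean`) by first-order optimality, instead of via Helton–Vinnikov as in loc. cit.
* `eq_zero_of_mem_of_neg_mem` — a smooth hyperbolicity cone of degree `≥ 2` is **pointed**
  (replaces the lineality-space reduction of loc. cit., §3).
* `eventually_mem_hyperbolicityCone_iff` — **local structure**: near a smooth boundary point,
  `b ∈ Λ₊ ↔ f(b) ≥ 0` (for `f(e) > 0`), as used in the proof of N–S Thm 3.1.
* `linePoly_eq_C_mul_prodOneAdd`, `linePoly_dir_eq_C_mul_prodOneAdd_eigenvalues` — for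
  `w ∈ Λ₊₊`, `f(w + uv) = f(w) ∏ᵢ (1 + μᵢ u)` with real `μᵢ` (Gårding), in particular
  `f(e + ux) = f(e) ∏ (1 + λᵢ(x) u)`; `coeff_linePoly_facts_of_interior`.
* `coeff_two_linePoly_neg_of_interior` — **N–S Lemma 2.4 (i)**: strict quasi-concavity of `f` at
  interior points of a pointed cone.
* `coeff_two_linePoly_neg_of_boundary` — **N–S Lemma 2.4 (ii)**: strict quasi-concavity at smooth
  boundary points along directions on which `f` is not identically zero (elementary limit
  argument along `b + se`, `s → 0⁺`, replacing the Helton–Vinnikov proof of loc. cit.).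

## References

* [NetzerSanyal2014] T. Netzer, R. Sanyal, *Smooth hyperbolicity cones are spectrahedral shadows*,
  Math. Program. 153 (2015) 213–221 (arXiv:1208.0441): §2 (Lemma 2.1, Remark 2.2, strict
  quasi-concavity, Lemma 2.4), §3 (proof of Thm 3.1: local structure; pointedness).
* [Renegar2006] J. Renegar, *Hyperbolic programs, and their derivative relaxations*, Found.
  Comput. Math. 6 (2006) 59–79, §2 (`p(x) = p(e)∏λⱼ(x)`, signs on the cone).
-/

noncomputable section

open MvPolynomial Filter Topology
open scoped BigOperators Polynomial

namespace Literature.AlgebraicGeometry.HyperbolicPolynomials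

variable {σ : Type*}

/-! ### The gradient pairing as a linear form -/

section Grad

variable {R : Type*} [CommRing R]

/-- The map `v ↦ coeff 1 (linePoly f x v)` is linear (it is `v ↦ ⟨∇f(x), v⟩`). [folklore] -/
def gradForm [Fintype σ] (f : MvPolynomial σ R) (x : σ → R) : (σ → R) →ₗ[R] R where
  toFun v := ∑ j, v j * MvPolynomial.eval x (pderiv j f)
  map_add' v w := by
    simp only [Pi.add_apply, add_mul, Finset.sum_add_distrib]
  map_smul' c v := by
    simp only [Pi.smul_apply, smul_eq_mul, RingHom.id_apply, Finset.mul_sum, mul_assoc]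

/-- `gradForm f x v = coeff 1 (linePoly f x v)`. [folklore] -/
theorem gradForm_apply [Fintype σ] (f : MvPolynomial σ R) (x v : σ → R) :
    gradForm f x v = (linePoly f x v).coeff 1 := by
  rw [coeff_one_linePoly]; rfl

end Grad

/-! ### Sign of `f` on the cone; a coefficient lemma -/

section Sign

variable {f : MvPolynomial σ ℝ} {d : ℕ} {e : σ → ℝ}

/-- With `f(e) > 0`, `f ≥ 0` on `Λ₊` (`f(x) = f(e) ∏ λᵢ(x)`, Renegar 2006 §2). [cite: Renegar2006, §2] -/
theorem eval_nonneg_of_mem (hf : f.IsHomogeneous d) (he : IsHyperbolic f e)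
    (hpos : 0 < MvPolynomial.eval e f) {x : σ → ℝ} (hx : x ∈ hyperbolicityCone f e) :
    0 ≤ MvPolynomial.eval x f := by
  rw [eval_eq_eval_mul_prod_eigenvalues hf he x]
  exact mul_nonneg hpos.le (Multiset.prod_nonneg
    fun lam hlam => (mem_hyperbolicityCone_iff_eigenvalues_nonneg hf he x).1 hx lam hlam)

/-- With `f(e) > 0`, `f > 0` on `Λ₊₊`. [cite: Renegar2006, §2] -/
theorem eval_pos_of_mem (hf : f.IsHomogeneous d) (he : IsHyperbolic f e)
    (hpos : 0 < MvPolynomial.eval e f) {x : σ → ℝ} (hx : x ∈ openHyperbolicityCone f e) :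
    0 < MvPolynomial.eval x f := by
  rw [eval_eq_eval_mul_prod_eigenvalues hf he x]
  exact mul_pos hpos (Multiset.prod_pos
    fun lam hlam => (mem_openHyperbolicityCone_iff_eigenvalues_pos hf he x).1 hx lam hlam)

/-- A real polynomial vanishing at `0` and non-negative to the right of `0` has non-negative linear
coefficient. [folklore] -/
theorem _root_.Polynomial.coeff_one_nonneg_of_eventually_nonneg (P : ℝ[X]) (h0 : P.eval 0 = 0)
    (h : ∀ᶠ t in 𝓝[>] (0 : ℝ), 0 ≤ P.eval t) : 0 ≤ P.coeff 1 := by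
  have hP : P = Polynomial.X * P.divX := by
    conv_lhs => rw [← P.divX_mul_X_add, Polynomial.coeff_zero_eq_eval_zero, h0]
    simp [mul_comm]
  have hev : ∀ t, P.eval t = t * P.divX.eval t := fun t => by
    conv_lhs => rw [hP]
    simp
  have hlim : Tendsto (fun t => P.divX.eval t) (𝓝[>] (0 : ℝ)) (𝓝 (P.coeff 1)) := by
    have : P.divX.eval 0 = P.coeff 1 := by
      rw [← Polynomial.coeff_zero_eq_eval_zero, Polynomial.coeff_divX]
    rw [← this]
    exact ((P.divX.continuous).tendsto 0).mono_left nhdsWithin_le_nhds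
  refine ge_of_tendsto hlim ?_
  filter_upwards [h, self_mem_nhdsWithin] with t ht ht0
  rw [hev] at ht
  exact nonneg_of_mul_nonneg_right ht (Set.mem_Ioi.1 ht0)

end Sign

/-! ### Smooth boundary points: the direction `e` is transversal (N–S Lemma 2.1 / Remark 2.2 (ii)) -/

section Transversal

variable [Fintype σ] {f : MvPolynomial σ ℝ} {d : ℕ} {e : σ → ℝ}

omit [Fintype σ] in
/-- `t ↦ f(a + ta)` is the zero polynomial when `f(a) = 0` (homogeneity). [folklore] -/
theorem linePoly_self_eq_zero (hf : f.IsHomogeneous d) {a : σ → ℝ} (ha0 : MvPolynomial.eval a f = 0) :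
    linePoly f a a = 0 := by
  refine Polynomial.funext fun t => ?_
  rw [eval_linePoly, Polynomial.eval_zero, show a + t • a = (1 + t) • a by rw [add_smul, one_smul],
    hf.eval_smul_eq, ha0, mul_zero]

/-- **Transversality at smooth boundary points** (Netzer–Sanyal Remark 2.2 (ii) / Lemma 2.1, for
points of the cone; Renegar 2006): if `f(e) > 0`, `a ∈ Λ₊` with `f(a) = 0` and `∇f(a) ≠ 0`, then
`∂ₑf(a) > 0`. Proof: `f ≥ 0` on the convex set `Λ₊` and `f(a) = 0`, so `⟨∇f(a), y - a⟩ ≥ 0` for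
all `y ∈ Λ₊`; as `e` is interior and `⟨∇f(a), a⟩ = d f(a) = 0`, `⟨∇f(a), e⟩ = 0` would force
`∇f(a) = 0`. [cite: NetzerSanyal2014, Remark 2.2 (ii)] -/
theorem coeff_one_linePoly_dir_pos (hf : f.IsHomogeneous d) (he : IsHyperbolic f e)
    (hpos : 0 < MvPolynomial.eval e f) {a : σ → ℝ} (ha : a ∈ hyperbolicityCone f e)
    (ha0 : MvPolynomial.eval a f = 0) (hgrad : ∃ v, (linePoly f a v).coeff 1 ≠ 0) :
    0 < (linePoly f a e).coeff 1 := by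
  set L := gradForm f a with hL
  have hLv : ∀ v, L v = (linePoly f a v).coeff 1 := fun v => gradForm_apply f a v
  -- first-order optimality on the convex cone
  have hnn : ∀ y ∈ hyperbolicityCone f e, 0 ≤ L (y - a) := by
    intro y hy
    rw [hLv]
    refine Polynomial.coeff_one_nonneg_of_eventually_nonneg _
      (by rw [← Polynomial.coeff_zero_eq_eval_zero, coeff_zero_linePoly, ha0]) ?_
    filter_upwards [Ioo_mem_nhdsGT (zero_lt_one' ℝ)] with t ht
    rw [eval_linePoly]
    exact eval_nonneg_of_mem hf he hpos
      ((convex_hyperbolicityCone hf he).add_smul_sub_mem ha hy ⟨ht.1.le, ht.2.le⟩)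
  have hLa : L a = 0 := by rw [hLv, linePoly_self_eq_zero hf ha0, Polynomial.coeff_zero]
  have hLe : 0 ≤ L e := by simpa [map_sub, hLa] using hnn e (self_mem_hyperbolicityCone hf he.1)
  refine (hLv e) ▸ lt_of_le_of_ne hLe fun hLe0 => ?_
  -- if `L e = 0` then `L ≥ 0` near `0`, hence `L = 0`
  have hLy : ∀ y ∈ hyperbolicityCone f e, 0 ≤ L y := fun y hy => by
    simpa [map_sub, hLa] using hnn y hy
  have hnhds : ∀ᶠ w in 𝓝 (0 : σ → ℝ), e + w ∈ openHyperbolicityCone f e ∧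
      e - w ∈ openHyperbolicityCone f e := by
    have hopen := he.isOpen_openHyperbolicityCone hf
    have hmem := self_mem_openHyperbolicityCone hf he.1
    have h1 : Tendsto (fun w : σ → ℝ => e + w) (𝓝 0) (𝓝 e) :=
      (continuous_const.add continuous_id : Continuous fun w : σ → ℝ => e + w).tendsto' 0 e
        (by simp)
    have h2 : Tendsto (fun w : σ → ℝ => e - w) (𝓝 0) (𝓝 e) :=
      (continuous_const.sub continuous_id : Continuous fun w : σ → ℝ => e - w).tendsto' 0 e
        (by simp)
    exact (h1.eventually (hopen.mem_nhds hmem)).and (h2.eventually (hopen.mem_nhds hmem))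
  have hL0 : ∀ᶠ w in 𝓝 (0 : σ → ℝ), L w = 0 := by
    filter_upwards [hnhds] with w hw
    have h1 := hLy _ (openHyperbolicityCone_subset f e hw.1)
    have h2 := hLy _ (openHyperbolicityCone_subset f e hw.2)
    rw [map_add, ← hLe0, zero_add] at h1
    rw [map_sub, ← hLe0, zero_sub] at h2
    linarith
  obtain ⟨v, hv⟩ := hgrad
  rw [← hLv] at hv
  -- `ε • v` is near `0`
  have hsm : Tendsto (fun ε : ℝ => ε • v) (𝓝 0) (𝓝 0) :=
    (continuous_id.smul continuous_const : Continuous fun ε : ℝ => ε • v).tendsto' 0 0 (by simp)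
  obtain ⟨ε, hε, hεpos⟩ := (((hsm.eventually hL0).filter_mono nhdsWithin_le_nhds).and
    (self_mem_nhdsWithin (s := Set.Ioi (0 : ℝ)))).exists
  rw [map_smul, smul_eq_mul, mul_eq_zero] at hε
  rcases hε with h | h
  · exact (Set.mem_Ioi.1 hεpos).ne' h
  · exact hv h

/-- Sign-free version of `coeff_one_linePoly_dir_pos`: `∂ₑ f(a) ≠ 0` at smooth boundary points.
[cite: NetzerSanyal2014, Remark 2.2 (ii)] -/
theorem coeff_one_linePoly_dir_ne_zero (hf : f.IsHomogeneous d) (he : IsHyperbolic f e)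
    {a : σ → ℝ} (ha : a ∈ hyperbolicityCone f e) (ha0 : MvPolynomial.eval a f = 0)
    (hgrad : ∃ v, (linePoly f a v).coeff 1 ≠ 0) : (linePoly f a e).coeff 1 ≠ 0 := by
  rcases lt_or_gt_of_ne he.eval_ne_zero with hneg | hpos
  · -- replace `f` by `-f`
    have hf' : (-f).IsHomogeneous d := hf.neg
    have he' : IsHyperbolic (-f) e := isHyperbolic_neg_iff.2 he
    have hpos' : 0 < MvPolynomial.eval e (-f) := by rw [map_neg]; linarith
    have ha' : a ∈ hyperbolicityCone (-f) e := by rwa [hyperbolicityCone_neg]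
    have hgrad' : ∃ v, (linePoly (-f) a v).coeff 1 ≠ 0 := by
      obtain ⟨v, hv⟩ := hgrad
      exact ⟨v, by rwa [linePoly_neg, Polynomial.coeff_neg, neg_ne_zero]⟩
    have := coeff_one_linePoly_dir_pos hf' he' hpos' ha' (by rw [map_neg, ha0, neg_zero]) hgrad'
    rw [linePoly_neg, Polynomial.coeff_neg] at this
    linarith
  · exact (coeff_one_linePoly_dir_pos hf he hpos ha ha0 hgrad).ne'

/-- **Smooth hyperbolicity cones of degree `≥ 2` are pointed**: if every non-zero boundary point of
`Λ₊` is a smooth point of `f`, then `Λ₊ ∩ (-Λ₊) = {0}`. (A non-zero `x ∈ Λ₊ ∩ -Λ₊` has all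
eigenvalues `0`, so `f(x + te) = f(e) t^d`; then `f(x) = 0`, `x` is a boundary point, smooth by
hypothesis, and `∂ₑ f(x) ≠ 0` by transversality — contradicting `d ≥ 2`.) This replaces the
lineality-space reduction of Netzer–Sanyal, §3. [cite: NetzerSanyal2014, §3 (pointed)] -/
theorem eq_zero_of_mem_of_neg_mem (hf : f.IsHomogeneous d) (he : IsHyperbolic f e) (hd : 2 ≤ d)
    (hsmooth : ∀ a ∈ frontier (hyperbolicityCone f e), a ≠ 0 → ∃ v, (linePoly f a v).coeff 1 ≠ 0)
    {x : σ → ℝ} (hx : x ∈ hyperbolicityCone f e) (hnx : -x ∈ hyperbolicityCone f e) : x = 0 := by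
  by_contra hx0
  set P := linePoly f x e with hP
  have hcard : Multiset.card P.roots = d := by
    rw [he.card_roots_linePoly x, natDegree_linePoly hf he.1]
  have hroots0 : ∀ r ∈ P.roots, r = 0 := by
    intro r hr
    have hr' := (Polynomial.mem_roots (linePoly_ne_zero hf he.1 x)).1 hr
    rw [Polynomial.IsRoot.def, eval_linePoly] at hr'
    have h1 : r ≤ 0 := (mem_hyperbolicityCone_iff_forall_root_nonpos f e x).1 hx r hr'
    rcases h1.eq_or_lt with h | h
    · exact h
    · exfalso
      refine hnx (-r) (by linarith) ?_
      rw [show -x + -r • e = (-1 : ℝ) • (x + r • e) by simp [neg_smul], hf.eval_smul_eq, hr',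
        mul_zero]
  have hPeq : P = Polynomial.C (MvPolynomial.eval e f) * Polynomial.X ^ d := by
    have hfac := Polynomial.C_leadingCoeff_mul_prod_multiset_X_sub_C
      (by rw [hcard, natDegree_linePoly hf he.1] : Multiset.card P.roots = P.natDegree)
    rw [← hfac, leadingCoeff_linePoly hf he.1, (Multiset.eq_replicate.2 ⟨hcard, hroots0⟩ :
      P.roots = Multiset.replicate d 0)]
    simp
  have hx00 : MvPolynomial.eval x f = 0 := by
    have := coeff_zero_linePoly f x e
    rw [← hP, hPeq, Polynomial.coeff_C_mul, Polynomial.coeff_X_pow, if_neg (by omega)] at this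
    simpa using this.symm
  have hfr : x ∈ frontier (hyperbolicityCone f e) := by
    rw [frontier_hyperbolicityCone hf he]; exact ⟨hx, hx00⟩
  have h1 := coeff_one_linePoly_dir_ne_zero hf he hx hx00 (hsmooth x hfr hx0)
  rw [← hP, hPeq, Polynomial.coeff_C_mul, Polynomial.coeff_X_pow, if_neg (by omega)] at h1
  exact h1 (by simp)

end Transversal

/-! ### Local structure of the cone at a smooth boundary point -/

section LocalStructure

open Polynomial Complex

variable {f : MvPolynomial σ ℝ} {d : ℕ} {e : σ → ℝ}

/-- `cLinePoly` is the complexification of `linePoly`. [folklore] -/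
theorem cLinePoly_eq_map (f : MvPolynomial σ ℝ) (x b : σ → ℝ) :
    cLinePoly f x b = (linePoly f x b).map (algebraMap ℝ ℂ) := by
  rw [cLinePoly, map_linePoly]; rfl

/-- A form of degree `0` is constant: `f(a) = f(e)`. [folklore] -/
theorem IsHomogeneous.eval_eq_of_degree_zero (hf : f.IsHomogeneous 0) (a e : σ → ℝ) :
    MvPolynomial.eval a f = MvPolynomial.eval e f := by
  have h1 := hf.eval_smul_eq 0 a
  have h2 := hf.eval_smul_eq 0 e
  simp only [zero_smul, pow_zero, one_mul] at h1 h2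
  rw [← h1, ← h2]

/-- **Local structure at a smooth boundary point** (used by Netzer–Sanyal in the proof of Thm 3.1:
"locally at `a` the set is defined by `p ≥ 0`"): if `f(e) > 0`, `a ∈ Λ₊`, `f(a) = 0` and
`∂ₑ f(a) ≠ 0`, then near `a` membership in `Λ₊` is equivalent to `f ≥ 0`. Proof: near `a` the real-
rooted polynomial `t ↦ f(b + te)` has all its roots negative except at most one (counted with
multiplicity, by Rolle, since its derivative has no root near `0`) small one `t_b`, and
`sign f(b) = -sign t_b`. [cite: NetzerSanyal2014, proof of Theorem 3.1] -/
theorem eventually_mem_hyperbolicityCone_iff (hf : f.IsHomogeneous d) (he : IsHyperbolic f e)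
    (hpos : 0 < MvPolynomial.eval e f) {a : σ → ℝ} (ha : a ∈ hyperbolicityCone f e)
    (ha0 : MvPolynomial.eval a f = 0) (ha1 : (linePoly f a e).coeff 1 ≠ 0) :
    ∀ᶠ b in 𝓝 a, b ∈ hyperbolicityCone f e ↔ 0 ≤ MvPolynomial.eval b f := by
  classical
  have he0 := he.eval_ne_zero
  -- `d ≥ 1`
  obtain ⟨d', rfl⟩ : ∃ d', d = d' + 1 := by
    refine Nat.exists_eq_add_one_of_ne_zero ?_
    rintro rfl
    exact he0 (by rw [← IsHomogeneous.eval_eq_of_degree_zero hf a e, ha0])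
  -- the complexified family and its derivative
  set Q : (σ → ℝ) → ℂ[X] := fun b => cLinePoly f b e with hQ
  set D : (σ → ℝ) → ℂ[X] := fun b => derivative (cLinePoly f b e) with hD
  have hQdeg : ∀ b, (Q b).natDegree ≤ d' + 1 := fun b => (natDegree_cLinePoly hf he0 b).le
  have hQtop : ∀ b, (Q b).coeff (d' + 1) = ((MvPolynomial.eval e f : ℝ) : ℂ) := fun b =>
    coeff_cLinePoly_d hf b
  have hQlim : ∀ k, Tendsto (fun b => (Q b).coeff k) (𝓝 a) (𝓝 ((Q a).coeff k)) := fun k =>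
    (continuous_coeff_cLinePoly f e k).tendsto a
  have hDcoeff : ∀ b k, (D b).coeff k = (Q b).coeff (k + 1) * (k + 1) := fun b k =>
    coeff_derivative _ _
  have hDdeg : ∀ b, (D b).natDegree ≤ d' := fun b =>
    (natDegree_derivative_le _).trans (by simp only [hQ] at hQdeg ⊢; rw [natDegree_cLinePoly hf he0 b]; simp)
  have hDtop : ∀ b, (D b).coeff d' = ((MvPolynomial.eval e f : ℝ) : ℂ) * (d' + 1) := fun b => by
    rw [hDcoeff, hQtop]
  have hDtop_ne : ∀ b, (D b).coeff d' ≠ 0 := fun b => by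
    rw [hDtop]
    exact mul_ne_zero (by exact_mod_cast he0) (by exact_mod_cast Nat.succ_ne_zero d')
  have hDne : ∀ b, D b ≠ 0 := fun b h0 => hDtop_ne b (by rw [h0, Polynomial.coeff_zero])
  have hDlim : ∀ k, Tendsto (fun b => (D b).coeff k) (𝓝 a) (𝓝 ((D a).coeff k)) := fun k => by
    simp only [hDcoeff]
    exact (hQlim (k + 1)).mul tendsto_const_nhds
  have hDmap : ∀ b, D b = (derivative (linePoly f b e)).map (algebraMap ℝ ℂ) := fun b => by
    simp only [hD, cLinePoly_eq_map, derivative_map]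
  -- Step 1: the roots of `D a` stay away from `0`
  have hD0 : ¬ (D a).IsRoot 0 := by
    rw [IsRoot.def, ← coeff_zero_eq_eval_zero, hDcoeff, hQ]
    dsimp only
    rw [cLinePoly_eq_map, Polynomial.coeff_map]
    simpa using ha1
  obtain ⟨ρ, hρ, hball⟩ : ∃ ρ : ℝ, 0 < ρ ∧ ∀ τ ∈ (D a).roots, ρ < ‖τ‖ := by
    have hclosed : IsClosed ((D a).roots.toFinset : Set ℂ) := (D a).roots.toFinset.finite_toSet.isClosed
    have h0 : (0 : ℂ) ∈ ((D a).roots.toFinset : Set ℂ)ᶜ := fun h =>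
      hD0 ((mem_roots (hDne a)).1 (Multiset.mem_toFinset.1 h))
    obtain ⟨ρ, hρ, hsub⟩ := Metric.isOpen_iff.1 hclosed.isOpen_compl 0 h0
    refine ⟨ρ / 2, half_pos hρ, fun τ hτ => ?_⟩
    by_contra hle
    push Not at hle
    exact hsub (mem_ball_zero_iff.2 (lt_of_le_of_lt hle (half_lt_self hρ))) (Multiset.mem_toFinset.2 hτ)
  -- Step 2: eventually, roots of `D b` avoid the ball and roots of `Q b` are small or negative
  have ev1 : ∀ᶠ b in 𝓝 a, ∀ τ ∈ (D b).roots, τ ∈ {τ : ℂ | ρ < ‖τ‖} :=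
    eventually_roots_subset_of_isOpen hDdeg (hDdeg a) (hDtop_ne a) hDlim
      (isOpen_lt continuous_const continuous_norm) fun τ hτ => hball τ hτ
  have ev2 : ∀ᶠ b in 𝓝 a, ∀ τ ∈ (Q b).roots, τ ∈ Metric.ball (0 : ℂ) ρ ∪ {τ : ℂ | τ.re < 0} := by
    refine eventually_roots_subset_of_isOpen hQdeg (hQdeg a) (by rw [hQtop]; exact_mod_cast he0)
      hQlim (Metric.isOpen_ball.union (isOpen_lt continuous_re continuous_const)) fun τ hτ => ?_
    obtain ⟨hre, hev⟩ := he.root_cLinePoly ((mem_roots (cLinePoly_ne_zero hf he0 a)).1 hτ)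
    have hle : τ.re ≤ 0 := (mem_hyperbolicityCone_iff_forall_root_nonpos f e a).1 ha _ hev
    rcases hle.eq_or_lt with h | h
    · left
      rw [hre, h]
      simpa using hρ
    · exact Or.inr h
  -- Step 3
  filter_upwards [ev1, ev2] with b hb1 hb2
  refine ⟨fun hb => eval_nonneg_of_mem hf he hpos hb, fun hb0 => ?_⟩
  by_contra hb
  rw [mem_hyperbolicityCone_iff_forall_root_nonpos] at hb
  push Not at hb
  obtain ⟨t, ht, htpos⟩ := hb
  have hPne : linePoly f b e ≠ 0 := linePoly_ne_zero hf he0 b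
  have hQne : Q b ≠ 0 := cLinePoly_ne_zero hf he0 b
  -- real roots of `linePoly f b e` are small (`|r| < ρ`) or negative
  have hdich : ∀ r : ℝ, MvPolynomial.eval (b + r • e) f = 0 → |r| < ρ ∨ r < 0 := by
    intro r hr
    rcases hb2 (r : ℂ) ((mem_roots hQne).2 (isRoot_cLinePoly_ofReal hr)) with h | h
    · left
      simpa [Complex.norm_real] using h
    · right
      simpa using h
  have htρ : |t| < ρ := (hdich t ht).resolve_right (not_lt.2 htpos.le)
  -- the derivative has no small real root
  have hP'root : ∀ r : ℝ, |r| < ρ → ¬ (derivative (linePoly f b e)).IsRoot r := by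
    intro r hr hroot
    have h1 : (D b).IsRoot (algebraMap ℝ ℂ r) := by rw [hDmap]; exact hroot.map
    have h2 := hb1 _ ((mem_roots (hDne b)).2 h1)
    simp only [Complex.coe_algebraMap, Complex.norm_real, Real.norm_eq_abs] at h2
    linarith
  -- hence at most one small root, counted with multiplicity
  set F := (linePoly f b e).roots.filter (fun r => |r| < ρ) with hF
  have htF : t ∈ F :=
    Multiset.mem_filter.2 ⟨(mem_roots hPne).2 (by rw [IsRoot.def, eval_linePoly]; exact ht), htρ⟩
  have hFcard : Multiset.card F ≤ 1 := by
    by_contra hcard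
    push Not at hcard
    obtain ⟨r₂, hr₂⟩ : ∃ r₂, r₂ ∈ F.erase t :=
      Multiset.card_pos_iff_exists_mem.1
        (by rw [Multiset.card_erase_of_mem htF, Nat.pred_eq_sub_one]; omega)
    have hr₂F : r₂ ∈ F := Multiset.mem_of_mem_erase hr₂
    obtain ⟨hr₂root, hr₂abs⟩ := Multiset.mem_filter.1 hr₂F
    by_cases hrt : r₂ = t
    · subst hrt
      have hcount : 2 ≤ (linePoly f b e).roots.count r₂ := by
        have h1 : 1 ≤ (F.erase r₂).count r₂ := Multiset.one_le_count_iff_mem.2 hr₂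
        rw [Multiset.count_erase_self] at h1
        have h2 : F.count r₂ = (linePoly f b e).roots.count r₂ := Multiset.count_filter_of_pos hr₂abs
        omega
      rw [count_roots] at hcount
      have hder0 : derivative (linePoly f b e) ≠ 0 := fun h0 => by
        have := hDne b; rw [hDmap, h0, Polynomial.map_zero] at this; exact this rfl
      have hder := rootMultiplicity_sub_one_le_derivative_rootMultiplicity_of_ne_zero
        (linePoly f b e) r₂ hder0
      exact hP'root r₂ hr₂abs ((rootMultiplicity_pos hder0).1 (by omega))
    · have hev₂ : (linePoly f b e).eval r₂ = 0 := (mem_roots hPne).1 hr₂root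
      have hevt : (linePoly f b e).eval t = 0 := by rw [eval_linePoly]; exact ht
      have hcont : Continuous fun s : ℝ => (linePoly f b e).eval s := Polynomial.continuous _
      rcases lt_or_gt_of_ne hrt with hlt | hgt
      · obtain ⟨c, hc, hc0⟩ := exists_deriv_eq_zero hlt hcont.continuousOn (hev₂.trans hevt.symm)
        rw [Polynomial.deriv] at hc0
        refine hP'root c (abs_lt.2 ⟨?_, ?_⟩) hc0
        · linarith [hc.1, (abs_lt.1 hr₂abs).1]
        · linarith [hc.2, (abs_lt.1 htρ).2]
      · obtain ⟨c, hc, hc0⟩ := exists_deriv_eq_zero hgt hcont.continuousOn (hevt.trans hev₂.symm)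
        rw [Polynomial.deriv] at hc0
        refine hP'root c (abs_lt.2 ⟨?_, ?_⟩) hc0
        · linarith [hc.1, (abs_lt.1 htρ).1]
        · linarith [hc.2, (abs_lt.1 hr₂abs).2]
  have hFeq : F = {t} :=
    (Multiset.eq_of_le_of_card_le (Multiset.singleton_le.2 htF) (by simpa using hFcard)).symm
  -- the product formula at `t = 0`
  have hprod := he.eval_add_smul_eq_prod_roots b 0
  rw [zero_smul, add_zero, leadingCoeff_linePoly hf he0,
    ← Multiset.filter_add_not (fun r => |r| < ρ) (linePoly f b e).roots, Multiset.map_add,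
    Multiset.prod_add, ← hF, hFeq] at hprod
  have hGpos : 0 < (((linePoly f b e).roots.filter fun r => ¬ |r| < ρ).map
      fun μ => (0 : ℝ) - μ).prod := by
    refine Multiset.prod_pos fun y hy => ?_
    obtain ⟨r, hr, rfl⟩ := Multiset.mem_map.1 hy
    obtain ⟨hrroot, hrabs⟩ := Multiset.mem_filter.1 hr
    have hrev : MvPolynomial.eval (b + r • e) f = 0 := by
      have := (mem_roots hPne).1 hrroot
      rwa [IsRoot.def, eval_linePoly] at this
    have := (hdich r hrev).resolve_left hrabs
    linarith
  have hneg : MvPolynomial.eval b f < 0 := by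
    rw [hprod]
    simp only [Multiset.map_singleton, Multiset.prod_singleton]
    have ht' : (0 : ℝ) - t < 0 := by linarith
    exact mul_neg_of_pos_of_neg hpos (mul_neg_of_neg_of_pos ht' hGpos)
  linarith

end LocalStructure

/-! ### The product form `f(w + uv) = f(w) ∏ (1 + μᵢ u)` and strict quasi-concavity (N–S Lemma 2.4) -/

section QuasiConcave

open Polynomial

variable {f : MvPolynomial σ ℝ} {d : ℕ} {e : σ → ℝ}

/-- `∏ᵢ (1 + μᵢ X) ∈ ℝ[X]`. [folklore] -/
def prodOneAdd (μ : Multiset ℝ) : ℝ[X] := (μ.map fun m => 1 + Polynomial.C m * Polynomial.X).prod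

/-- [folklore] -/
@[simp] theorem prodOneAdd_zero : prodOneAdd 0 = 1 := by simp [prodOneAdd]

/-- [folklore] -/
theorem prodOneAdd_cons (m : ℝ) (μ : Multiset ℝ) :
    prodOneAdd (m ::ₘ μ) = (1 + Polynomial.C m * Polynomial.X) * prodOneAdd μ := by
  simp [prodOneAdd]

/-- [folklore] -/
theorem eval_prodOneAdd (μ : Multiset ℝ) (u : ℝ) :
    (prodOneAdd μ).eval u = (μ.map fun m => 1 + m * u).prod := by
  rw [prodOneAdd, Polynomial.eval_multiset_prod, Multiset.map_map]
  exact congrArg Multiset.prod (Multiset.map_congr rfl fun m _ => by simp)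

/-- Coefficient recursion. [folklore] -/
theorem coeff_succ_prodOneAdd_cons (m : ℝ) (μ : Multiset ℝ) (k : ℕ) :
    (prodOneAdd (m ::ₘ μ)).coeff (k + 1) =
      (prodOneAdd μ).coeff (k + 1) + m * (prodOneAdd μ).coeff k := by
  rw [prodOneAdd_cons, add_mul, one_mul, Polynomial.coeff_add, mul_assoc, Polynomial.coeff_C_mul,
    Polynomial.coeff_X_mul]

/-- [folklore] -/
theorem coeff_zero_prodOneAdd (μ : Multiset ℝ) : (prodOneAdd μ).coeff 0 = 1 := by
  induction μ using Multiset.induction_on with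
  | empty => simp
  | cons m μ ih =>
      rw [prodOneAdd_cons, add_mul, one_mul, Polynomial.coeff_add, mul_assoc, Polynomial.coeff_C_mul,
        Polynomial.coeff_X_mul_zero, mul_zero, add_zero, ih]

/-- `coeff 1 (∏ (1 + μᵢ X)) = Σ μᵢ`. [folklore] -/
theorem coeff_one_prodOneAdd (μ : Multiset ℝ) : (prodOneAdd μ).coeff 1 = μ.sum := by
  induction μ using Multiset.induction_on with
  | empty => simp [Polynomial.coeff_one]
  | cons m μ ih => rw [coeff_succ_prodOneAdd_cons, ih, coeff_zero_prodOneAdd, Multiset.sum_cons]; ring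

/-- `2 coeff 2 (∏ (1 + μᵢ X)) = (Σ μᵢ)² - Σ μᵢ²`. [folklore] -/
theorem two_mul_coeff_two_prodOneAdd (μ : Multiset ℝ) :
    2 * (prodOneAdd μ).coeff 2 = μ.sum ^ 2 - (μ.map (· ^ 2)).sum := by
  induction μ using Multiset.induction_on with
  | empty => simp [Polynomial.coeff_one]
  | cons m μ ih =>
      rw [coeff_succ_prodOneAdd_cons, coeff_one_prodOneAdd, Multiset.sum_cons, Multiset.map_cons,
        Multiset.sum_cons, mul_add, ih]
      ring

/-- `|coeff k (∏ (1 + μᵢ X))| ≤ (card choose k) M^k` when all `|μᵢ| ≤ M`. [folklore] -/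
theorem abs_coeff_prodOneAdd_le (μ : Multiset ℝ) {M : ℝ} (hM0 : 0 ≤ M) (hM : ∀ m ∈ μ, |m| ≤ M)
    (k : ℕ) : |(prodOneAdd μ).coeff k| ≤ (Multiset.card μ).choose k * M ^ k := by
  induction μ using Multiset.induction_on generalizing k with
  | empty =>
      cases k with
      | zero => simp
      | succ k => simp [Polynomial.coeff_one]
  | cons m μ ih =>
      have hm : |m| ≤ M := hM m (Multiset.mem_cons_self m μ)
      have hμ : ∀ m' ∈ μ, |m'| ≤ M := fun m' hm' => hM m' (Multiset.mem_cons_of_mem hm')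
      cases k with
      | zero => rw [coeff_zero_prodOneAdd]; simp
      | succ k =>
          rw [coeff_succ_prodOneAdd_cons, Multiset.card_cons, Nat.choose_succ_succ, Nat.cast_add]
          have hA : |(prodOneAdd μ).coeff (k + 1)| ≤ (Multiset.card μ).choose (k + 1) * M ^ (k + 1) :=
            ih hμ (k + 1)
          have hB : |m * (prodOneAdd μ).coeff k| ≤ (Multiset.card μ).choose k * M ^ (k + 1) := by
            rw [abs_mul, pow_succ]
            calc |m| * |(prodOneAdd μ).coeff k| ≤ M * ((Multiset.card μ).choose k * M ^ k) :=
                  mul_le_mul hm (ih hμ k) (abs_nonneg _) hM0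
              _ = (Multiset.card μ).choose k * (M ^ k * M) := by ring
          calc _ ≤ _ := abs_add_le _ _
            _ ≤ (Multiset.card μ).choose (k + 1) * M ^ (k + 1) +
                  (Multiset.card μ).choose k * M ^ (k + 1) := add_le_add hA hB
            _ = _ := by ring

/-- **The product form along lines through interior points** (the elementary engine behind N–S
Lemma 2.4): for `w ∈ Λ₊₊` and any direction `v`, `f(w + uv) = f(w) ∏ᵢ (1 + μᵢ u)` with `d` real
numbers `μᵢ` (the negatives of the roots of `u ↦ f(v + uw)`, real by Gårding's theorem).
[cite: NetzerSanyal2014, proof of Lemma 2.4 (i)] -/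
theorem linePoly_eq_C_mul_prodOneAdd (hf : f.IsHomogeneous d) (he : IsHyperbolic f e)
    {w : σ → ℝ} (hw : w ∈ openHyperbolicityCone f e) (v : σ → ℝ) :
    linePoly f w v =
      Polynomial.C (MvPolynomial.eval w f) * prodOneAdd ((linePoly f v w).roots.map fun r => -r) := by
  have hwh : IsHyperbolic f w := he.of_mem_openHyperbolicityCone hf hw
  have hw0 : MvPolynomial.eval w f ≠ 0 := hwh.eval_ne_zero
  have hcard : Multiset.card (linePoly f v w).roots = d := by
    rw [hwh.card_roots_linePoly, natDegree_linePoly hf hw0]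
  refine Polynomial.funext fun u => ?_
  rw [eval_linePoly, Polynomial.eval_mul, Polynomial.eval_C, eval_prodOneAdd, Multiset.map_map]
  rcases eq_or_ne u 0 with rfl | hu
  · simp
  · have h1 : w + u • v = u • (v + u⁻¹ • w) := by
      rw [smul_add, smul_smul, mul_inv_cancel₀ hu, one_smul, add_comm]
    rw [h1, hf.eval_smul_eq, hwh.eval_add_smul_eq_prod_roots v u⁻¹, leadingCoeff_linePoly hf hw0]
    calc u ^ d * (MvPolynomial.eval w f * ((linePoly f v w).roots.map fun r => u⁻¹ - r).prod)
        = MvPolynomial.eval w f * ((((linePoly f v w).roots.map fun _ => u).prod) *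
            ((linePoly f v w).roots.map fun r => u⁻¹ - r).prod) := by
          rw [Multiset.map_const', Multiset.prod_replicate, hcard]; ring
      _ = MvPolynomial.eval w f * ((linePoly f v w).roots.map fun r => u * (u⁻¹ - r)).prod := by
          rw [← Multiset.prod_map_mul]
      _ = _ := by
          congr 1
          refine congrArg Multiset.prod (Multiset.map_congr rfl fun r _ => ?_)
          simp only [Function.comp_apply, mul_sub, mul_inv_cancel₀ hu]
          ring

/-- Existential form of `linePoly_eq_C_mul_prodOneAdd` with the count `d` of the `μᵢ`.
[cite: NetzerSanyal2014, proof of Lemma 2.4 (i)] -/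
theorem exists_linePoly_eq_C_mul_prodOneAdd (hf : f.IsHomogeneous d) (he : IsHyperbolic f e)
    {w : σ → ℝ} (hw : w ∈ openHyperbolicityCone f e) (v : σ → ℝ) :
    ∃ μ : Multiset ℝ, Multiset.card μ = d ∧
      linePoly f w v = Polynomial.C (MvPolynomial.eval w f) * prodOneAdd μ := by
  have hwh : IsHyperbolic f w := he.of_mem_openHyperbolicityCone hf hw
  refine ⟨(linePoly f v w).roots.map fun r => -r, ?_, linePoly_eq_C_mul_prodOneAdd hf he hw v⟩
  rw [Multiset.card_map, hwh.card_roots_linePoly, natDegree_linePoly hf hwh.eval_ne_zero]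

/-- The case `w = e`, `v = x`: **`f(e + ux) = f(e) ∏ᵢ (1 + λᵢ(x) u)`** with the eigenvalues of `x`
(Renegar 2006, §2). [cite: Renegar2006, §2] -/
theorem linePoly_dir_eq_C_mul_prodOneAdd_eigenvalues (hf : f.IsHomogeneous d) (he : IsHyperbolic f e)
    (x : σ → ℝ) :
    linePoly f e x = Polynomial.C (MvPolynomial.eval e f) * prodOneAdd (eigenvalues f e x) :=
  linePoly_eq_C_mul_prodOneAdd hf he (self_mem_openHyperbolicityCone hf he.eval_ne_zero) x

/-- **Strict quasi-concavity at interior points** (Netzer–Sanyal, Lemma 2.4 (i)): if `f(e) > 0`,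
`Λ₊` is pointed, `w ∈ Λ₊₊` and `v ≠ 0` with `∂ᵥ f(w) = 0`, then `∂ᵥ² f(w) < 0`. (With
`f(w + uv) = f(w)∏(1 + μᵢu)`: `Σμᵢ = 0` forces `2·coeff₂ = -f(w) Σμᵢ² ≤ 0`, with equality only if
`f` is constant on the line, which would put `±v` in `Λ₊`.) [cite: NetzerSanyal2014, Lemma 2.4 (i)] -/
theorem coeff_two_linePoly_neg_of_interior (hf : f.IsHomogeneous d) (he : IsHyperbolic f e)
    (hpos : 0 < MvPolynomial.eval e f)
    (hpt : ∀ x ∈ hyperbolicityCone f e, -x ∈ hyperbolicityCone f e → x = 0)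
    {w : σ → ℝ} (hw : w ∈ openHyperbolicityCone f e) {v : σ → ℝ} (hv : v ≠ 0)
    (h1 : (linePoly f w v).coeff 1 = 0) : (linePoly f w v).coeff 2 < 0 := by
  obtain ⟨μ, hcard, hfac⟩ := exists_linePoly_eq_C_mul_prodOneAdd hf he hw v
  have hc : 0 < MvPolynomial.eval w f := eval_pos_of_mem hf he hpos hw
  have hsum : μ.sum = 0 := by
    rw [hfac, Polynomial.coeff_C_mul, coeff_one_prodOneAdd] at h1
    exact (mul_eq_zero.1 h1).resolve_left hc.ne'
  have h2 : 2 * (linePoly f w v).coeff 2 = -(MvPolynomial.eval w f * (μ.map (· ^ 2)).sum) := by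
    rw [hfac, Polynomial.coeff_C_mul, mul_left_comm, two_mul_coeff_two_prodOneAdd, hsum]; ring
  have hsq_nonneg : ∀ x ∈ μ.map (· ^ 2), (0 : ℝ) ≤ x := by
    intro x hx
    obtain ⟨m, -, rfl⟩ := Multiset.mem_map.1 hx
    positivity
  by_contra hge
  push Not at hge
  have hS0 : (μ.map (· ^ 2)).sum = 0 := by
    refine le_antisymm ?_ (Multiset.sum_nonneg hsq_nonneg)
    by_contra hS
    push Not at hS
    have : 0 < MvPolynomial.eval w f * (μ.map (· ^ 2)).sum := mul_pos hc hS
    linarith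
  have hμ0 : ∀ m ∈ μ, m = 0 := by
    intro m hm
    have hle : m ^ 2 ≤ (μ.map (· ^ 2)).sum :=
      Multiset.single_le_sum hsq_nonneg _ (Multiset.mem_map_of_mem (· ^ 2) hm)
    rw [hS0] at hle
    exact (pow_eq_zero_iff two_ne_zero).1 (le_antisymm hle (sq_nonneg m))
  have hprod1 : prodOneAdd μ = 1 := by
    rw [(Multiset.eq_replicate.2 ⟨hcard, hμ0⟩ : μ = Multiset.replicate d 0), prodOneAdd]
    simp
  rw [hprod1, mul_one] at hfac
  have hconst : ∀ u : ℝ, MvPolynomial.eval (w + u • v) f = MvPolynomial.eval w f := fun u => by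
    rw [← eval_linePoly, hfac, Polynomial.eval_C]
  have hmem : ∀ s : ℝ, s • v ∈ hyperbolicityCone f e := by
    intro s
    rw [← hyperbolicityCone_eq_of_mem hf he hw]
    intro τ hτ
    have : s • v + τ • w = τ • (w + (s / τ) • v) := by
      rw [smul_add, smul_smul, mul_div_cancel₀ _ hτ.ne', add_comm]
    rw [this, hf.eval_smul_eq, hconst]
    exact mul_ne_zero (pow_ne_zero _ hτ.ne') hc.ne'
  exact hv (hpt v (by simpa using hmem 1) (by simpa using hmem (-1)))

/-- Consequences of the product form at an interior point `w` for the coefficients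
`cₖ = coeff k (linePoly f w v)`: `c₀ > 0`, `2c₀c₂ ≤ c₁²`, and if `(c₁/c₀)² - 2c₂/c₀ ≤ B` then
`|cₖ| ≤ c₀ · C(d,k) · B^{k/2}`. [cite: NetzerSanyal2014, proof of Lemma 2.4] -/
theorem coeff_linePoly_facts_of_interior (hf : f.IsHomogeneous d) (he : IsHyperbolic f e)
    (hpos : 0 < MvPolynomial.eval e f) {w : σ → ℝ} (hw : w ∈ openHyperbolicityCone f e)
    (v : σ → ℝ) :
    0 < (linePoly f w v).coeff 0 ∧
    2 * (linePoly f w v).coeff 0 * (linePoly f w v).coeff 2 ≤ (linePoly f w v).coeff 1 ^ 2 ∧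
    ∀ B : ℝ, 0 ≤ B →
      ((linePoly f w v).coeff 1 / (linePoly f w v).coeff 0) ^ 2 -
          2 * ((linePoly f w v).coeff 2 / (linePoly f w v).coeff 0) ≤ B →
      ∀ k, |(linePoly f w v).coeff k| ≤
        (linePoly f w v).coeff 0 * ((d.choose k : ℝ) * Real.sqrt B ^ k) := by
  obtain ⟨μ, hcard, hfac⟩ := exists_linePoly_eq_C_mul_prodOneAdd hf he hw v
  have hC0 : 0 < MvPolynomial.eval w f := eval_pos_of_mem hf he hpos hw
  have hck : ∀ k, (linePoly f w v).coeff k = MvPolynomial.eval w f * (prodOneAdd μ).coeff k :=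
    fun k => by rw [hfac, Polynomial.coeff_C_mul]
  have e0 : (linePoly f w v).coeff 0 = MvPolynomial.eval w f := by
    rw [hck, coeff_zero_prodOneAdd, mul_one]
  have e1 : (linePoly f w v).coeff 1 = MvPolynomial.eval w f * μ.sum := by
    rw [hck, coeff_one_prodOneAdd]
  have e2 : 2 * (linePoly f w v).coeff 2 =
      MvPolynomial.eval w f * (μ.sum ^ 2 - (μ.map (· ^ 2)).sum) := by
    rw [hck, mul_left_comm, two_mul_coeff_two_prodOneAdd]
  have hsq_nonneg : ∀ x ∈ μ.map (· ^ 2), (0 : ℝ) ≤ x := by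
    intro x hx
    obtain ⟨m, -, rfl⟩ := Multiset.mem_map.1 hx
    positivity
  have hSnn : 0 ≤ (μ.map (· ^ 2)).sum := Multiset.sum_nonneg hsq_nonneg
  refine ⟨by rw [e0]; exact hC0, ?_, fun B hB hSB k => ?_⟩
  · rw [e0, e1]
    have key : 2 * MvPolynomial.eval w f * (linePoly f w v).coeff 2 =
        (MvPolynomial.eval w f * μ.sum) ^ 2 - MvPolynomial.eval w f ^ 2 * (μ.map (· ^ 2)).sum := by
      linear_combination (MvPolynomial.eval w f) * e2
    rw [key]
    nlinarith [sq_nonneg (MvPolynomial.eval w f)]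
  · have hq1 : (linePoly f w v).coeff 1 / (linePoly f w v).coeff 0 = μ.sum := by
      rw [e1, e0, mul_div_cancel_left₀ _ hC0.ne']
    have hq2 : 2 * ((linePoly f w v).coeff 2 / (linePoly f w v).coeff 0) =
        μ.sum ^ 2 - (μ.map (· ^ 2)).sum := by
      rw [← mul_div_assoc, e2, e0, mul_div_cancel_left₀ _ hC0.ne']
    have hS : (μ.map (· ^ 2)).sum ≤ B := by
      rw [hq1, hq2] at hSB
      linarith
    have hmB : ∀ m ∈ μ, |m| ≤ Real.sqrt B := fun m hm =>
      Real.abs_le_sqrt ((Multiset.single_le_sum hsq_nonneg _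
        (Multiset.mem_map_of_mem (· ^ 2) hm)).trans hS)
    have hbound := abs_coeff_prodOneAdd_le μ (Real.sqrt_nonneg B) hmB k
    rw [hcard] at hbound
    rw [hck k, e0, abs_mul, abs_of_pos hC0]
    exact mul_le_mul_of_nonneg_left hbound hC0.le

/-- A real polynomial vanishing at `0` is `O(s)` on `[0, 1]`. [folklore] -/
theorem _root_.Polynomial.exists_abs_eval_le_mul (P : ℝ[X]) (h0 : P.eval 0 = 0) :
    ∃ K : ℝ, 0 ≤ K ∧ ∀ s ∈ Set.Icc (0 : ℝ) 1, |P.eval s| ≤ K * s := by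
  have hev : ∀ t, P.eval t = t * P.divX.eval t := fun t => by
    conv_lhs => rw [← P.divX_mul_X_add, Polynomial.coeff_zero_eq_eval_zero, h0]
    simp [mul_comm]
  obtain ⟨K, hK⟩ := isCompact_Icc.exists_bound_of_continuousOn
    (P.divX.continuous.continuousOn (s := Set.Icc (0 : ℝ) 1))
  refine ⟨max K 0, le_max_right _ _, fun s hs => ?_⟩
  rw [hev, abs_mul, abs_of_nonneg hs.1, mul_comm]
  refine mul_le_mul_of_nonneg_right (((Real.norm_eq_abs _).symm.le.trans (hK s hs)).trans
    (le_max_left _ _)) hs.1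

/-- A real polynomial with `P(0) = 0 < P'(0)` is bounded below by `(P'(0)/2) s` for small `s > 0`.
[folklore] -/
theorem _root_.Polynomial.eventually_mul_le_eval (P : ℝ[X]) (h0 : P.eval 0 = 0)
    (h1 : 0 < P.coeff 1) : ∀ᶠ s in 𝓝[>] (0 : ℝ), P.coeff 1 / 2 * s ≤ P.eval s := by
  have hev : ∀ t, P.eval t = t * P.divX.eval t := fun t => by
    conv_lhs => rw [← P.divX_mul_X_add, Polynomial.coeff_zero_eq_eval_zero, h0]
    simp [mul_comm]
  have hq0 : P.divX.eval 0 = P.coeff 1 := by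
    rw [← Polynomial.coeff_zero_eq_eval_zero, Polynomial.coeff_divX]
  have hlim : Tendsto (fun t => P.divX.eval t) (𝓝[>] (0 : ℝ)) (𝓝 (P.coeff 1)) := by
    rw [← hq0]; exact ((P.divX.continuous).tendsto 0).mono_left nhdsWithin_le_nhds
  filter_upwards [(tendsto_order.1 hlim).1 _ (half_lt_self h1), self_mem_nhdsWithin] with s hs hs0
  rw [hev]
  nlinarith [Set.mem_Ioi.1 hs0, hs]

/-- The coefficients `s ↦ coeff k (linePoly f (b + s e) v)` along the ray `b + ℝ₊ e`.
[cite: NetzerSanyal2014, proof of Lemma 2.4 (ii)] -/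
def bdryCoeff (f : MvPolynomial σ ℝ) (b e v : σ → ℝ) (k : ℕ) (s : ℝ) : ℝ :=
  (linePoly f (b + s • e) v).coeff k

/-- `bdryCoeff` is a polynomial function of `s`. [folklore] -/
theorem bdryCoeff_eq_eval (f : MvPolynomial σ ℝ) (b e v : σ → ℝ) (k : ℕ) (s : ℝ) :
    bdryCoeff f b e v k s = (linePoly ((linePolyGen f v).coeff k) b e).eval s := by
  rw [bdryCoeff, eval_linePoly, coeff_linePoly_eq_eval_linePolyGen]

/-- [folklore] -/
theorem bdryCoeff_at_zero (f : MvPolynomial σ ℝ) (b e v : σ → ℝ) (k : ℕ) :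
    bdryCoeff f b e v k 0 = (linePoly f b v).coeff k := by
  simp [bdryCoeff]

/-- [folklore] -/
theorem bdryCoeff_zero (f : MvPolynomial σ ℝ) (b e v : σ → ℝ) (s : ℝ) :
    bdryCoeff f b e v 0 s = (linePoly f b e).eval s := by
  rw [bdryCoeff, coeff_zero_linePoly, eval_linePoly]

/-- [folklore] -/
theorem tendsto_bdryCoeff (f : MvPolynomial σ ℝ) (b e v : σ → ℝ) (k : ℕ) :
    Tendsto (bdryCoeff f b e v k) (𝓝[>] 0) (𝓝 ((linePoly f b v).coeff k)) := by
  rw [show bdryCoeff f b e v k = fun s => (linePoly ((linePolyGen f v).coeff k) b e).eval s from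
    funext (bdryCoeff_eq_eval f b e v k), ← bdryCoeff_at_zero, bdryCoeff_eq_eval]
  exact ((Polynomial.continuous _).tendsto 0).mono_left nhdsWithin_le_nhds

/-- `bdryCoeff … k = O(s)` on `(0,1)` when it vanishes at `s = 0`. [folklore] -/
theorem eventually_abs_bdryCoeff_le (f : MvPolynomial σ ℝ) (b e v : σ → ℝ) {k : ℕ}
    (hk : (linePoly f b v).coeff k = 0) :
    ∃ K : ℝ, 0 ≤ K ∧ ∀ᶠ s in 𝓝[>] (0 : ℝ), |bdryCoeff f b e v k s| ≤ K * s := by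
  obtain ⟨K, hK0, hK⟩ := (linePoly ((linePolyGen f v).coeff k) b e).exists_abs_eval_le_mul
    (by rw [← bdryCoeff_eq_eval, bdryCoeff_at_zero, hk])
  refine ⟨K, hK0, ?_⟩
  filter_upwards [Ioo_mem_nhdsGT (zero_lt_one' ℝ)] with s hs
  rw [bdryCoeff_eq_eval]
  exact hK s ⟨hs.1.le, hs.2.le⟩

/-- **Strict quasi-concavity at smooth boundary points** (Netzer–Sanyal, Lemma 2.4 (ii); proved
there via Helton–Vinnikov, here by the elementary engine): if `f(e) > 0`, `b ∈ Λ₊` with `f(b) = 0`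
and `∂ₑ f(b) > 0`, and `v` is a direction with `∂ᵥ f(b) = 0` along which `f` does not vanish
identically, then `∂ᵥ² f(b) < 0`. Proof: for `w_s = b + se`, `s → 0⁺`, the coefficients
`cₖ(s)` of `u ↦ f(w_s + uv) = c₀(s) ∏ (1 + μᵢ(s)u)` converge to those at `b`; `c₀(s) ≍ s`,
`c₁(s) = O(s)`, and `2c₀c₂ ≤ c₁²` gives `c₂(0) ≤ 0`; if `c₂(0) = 0` then `Σμᵢ(s)²` stays bounded,
so every `cₖ(s) = c₀(s)·O(1) → 0` and `f` vanishes on the line. [cite: NetzerSanyal2014, Lemma 2.4 (ii)] -/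
theorem coeff_two_linePoly_neg_of_boundary (hf : f.IsHomogeneous d) (he : IsHyperbolic f e)
    (hpos : 0 < MvPolynomial.eval e f) {b : σ → ℝ} (hb : b ∈ hyperbolicityCone f e)
    (hb0 : MvPolynomial.eval b f = 0) (hb1 : 0 < (linePoly f b e).coeff 1) {v : σ → ℝ}
    (h1 : (linePoly f b v).coeff 1 = 0) (hline : linePoly f b v ≠ 0) :
    (linePoly f b v).coeff 2 < 0 := by
  -- notation: `c k s`
  have hfacts : ∀ s : ℝ, 0 < s → 0 < bdryCoeff f b e v 0 s ∧
      2 * bdryCoeff f b e v 0 s * bdryCoeff f b e v 2 s ≤ bdryCoeff f b e v 1 s ^ 2 ∧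
      ∀ B : ℝ, 0 ≤ B → (bdryCoeff f b e v 1 s / bdryCoeff f b e v 0 s) ^ 2 -
          2 * (bdryCoeff f b e v 2 s / bdryCoeff f b e v 0 s) ≤ B →
        ∀ k, |bdryCoeff f b e v k s| ≤ bdryCoeff f b e v 0 s * ((d.choose k : ℝ) * Real.sqrt B ^ k) :=
    fun s hs => coeff_linePoly_facts_of_interior hf he hpos (add_smul_mem_openHyperbolicityCone hb hs) v
  -- `c₀(s) ≥ (α/2) s`
  have hP0 : (linePoly f b e).eval 0 = 0 := by
    rw [← Polynomial.coeff_zero_eq_eval_zero, coeff_zero_linePoly, hb0]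
  have ev0 : ∀ᶠ s in 𝓝[>] (0 : ℝ),
      (linePoly f b e).coeff 1 / 2 * s ≤ bdryCoeff f b e v 0 s ∧ 0 < s := by
    filter_upwards [(linePoly f b e).eventually_mul_le_eval hP0 hb1, self_mem_nhdsWithin]
      with s hs hs0
    exact ⟨by rw [bdryCoeff_zero]; exact hs, hs0⟩
  -- `c₁(s) = O(s)`
  obtain ⟨K₁, hK₁0, ev1⟩ := eventually_abs_bdryCoeff_le f b e v h1
  -- Part (a): `coeff 2 ≤ 0`
  have hbound2 : ∀ᶠ s in 𝓝[>] (0 : ℝ),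
      bdryCoeff f b e v 2 s ≤ K₁ ^ 2 / (linePoly f b e).coeff 1 * s := by
    filter_upwards [ev0, ev1] with s hs hs1
    obtain ⟨hc0s, hspos⟩ := hs
    obtain ⟨hpos0, hineq, -⟩ := hfacts s hspos
    have hc1sq : bdryCoeff f b e v 1 s ^ 2 ≤ (K₁ * s) ^ 2 := by
      have := abs_le.1 hs1
      nlinarith
    have hrhs : 0 ≤ K₁ ^ 2 / (linePoly f b e).coeff 1 * s :=
      mul_nonneg (div_nonneg (sq_nonneg _) hb1.le) hspos.le
    rcases le_or_gt (bdryCoeff f b e v 2 s) 0 with hneg | hposc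
    · exact hneg.trans hrhs
    · rw [div_mul_eq_mul_div, le_div_iff₀ hb1]
      nlinarith
  have hlim0 : Tendsto (fun s : ℝ => K₁ ^ 2 / (linePoly f b e).coeff 1 * s) (𝓝[>] 0) (𝓝 0) := by
    have : Tendsto (fun s : ℝ => K₁ ^ 2 / (linePoly f b e).coeff 1 * s) (𝓝 0)
        (𝓝 (K₁ ^ 2 / (linePoly f b e).coeff 1 * 0)) := tendsto_const_nhds.mul tendsto_id
    rw [mul_zero] at this
    exact this.mono_left nhdsWithin_le_nhds
  have hc2le : (linePoly f b v).coeff 2 ≤ 0 :=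
    le_of_tendsto_of_tendsto (tendsto_bdryCoeff f b e v 2) hlim0 hbound2
  refine lt_of_le_of_ne hc2le fun hc20 => hline ?_
  -- Part (b): if `coeff 2 = 0` then all coefficients vanish
  obtain ⟨K₂, hK₂0, ev2⟩ := eventually_abs_bdryCoeff_le f b e v hc20
  obtain ⟨B, hB0, hBdef⟩ : ∃ B : ℝ, 0 ≤ B ∧
      B = (2 * K₁ / (linePoly f b e).coeff 1) ^ 2 + 2 * (2 * K₂ / (linePoly f b e).coeff 1) :=
    ⟨_, by positivity, rfl⟩
  have hck_bound : ∀ k, ∀ᶠ s in 𝓝[>] (0 : ℝ),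
      |bdryCoeff f b e v k s| ≤ bdryCoeff f b e v 0 s * ((d.choose k : ℝ) * Real.sqrt B ^ k) := by
    intro k
    filter_upwards [ev0, ev1, ev2] with s hs hs1 hs2
    obtain ⟨hc0s, hspos⟩ := hs
    obtain ⟨hpos0, -, hBk⟩ := hfacts s hspos
    refine hBk B hB0 ?_ k
    have hden : 0 < (linePoly f b e).coeff 1 / 2 * s := mul_pos (half_pos hb1) hspos
    have hq1 : |bdryCoeff f b e v 1 s / bdryCoeff f b e v 0 s| ≤ 2 * K₁ / (linePoly f b e).coeff 1 := by
      rw [abs_div, abs_of_pos hpos0]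
      calc |bdryCoeff f b e v 1 s| / bdryCoeff f b e v 0 s
          ≤ (K₁ * s) / ((linePoly f b e).coeff 1 / 2 * s) :=
            div_le_div₀ (mul_nonneg hK₁0 hspos.le) hs1 hden hc0s
        _ = 2 * K₁ / (linePoly f b e).coeff 1 := by
            field_simp
    have hq2 : |bdryCoeff f b e v 2 s / bdryCoeff f b e v 0 s| ≤ 2 * K₂ / (linePoly f b e).coeff 1 := by
      rw [abs_div, abs_of_pos hpos0]
      calc |bdryCoeff f b e v 2 s| / bdryCoeff f b e v 0 s
          ≤ (K₂ * s) / ((linePoly f b e).coeff 1 / 2 * s) :=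
            div_le_div₀ (mul_nonneg hK₂0 hspos.le) hs2 hden hc0s
        _ = 2 * K₂ / (linePoly f b e).coeff 1 := by
            field_simp
    have hsq : (bdryCoeff f b e v 1 s / bdryCoeff f b e v 0 s) ^ 2 ≤
        (2 * K₁ / (linePoly f b e).coeff 1) ^ 2 := by
      have := abs_le.1 hq1
      nlinarith
    have h2' : -(2 * (bdryCoeff f b e v 2 s / bdryCoeff f b e v 0 s)) ≤
        2 * (2 * K₂ / (linePoly f b e).coeff 1) := by
      have := abs_le.1 hq2
      linarith
    rw [hBdef]
    linarith
  have hc0lim : Tendsto (bdryCoeff f b e v 0) (𝓝[>] 0) (𝓝 0) := by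
    have := tendsto_bdryCoeff f b e v 0
    rwa [coeff_zero_linePoly, hb0] at this
  have hck0 : ∀ k, (linePoly f b v).coeff k = 0 := by
    intro k
    have hzero : Tendsto (bdryCoeff f b e v k) (𝓝[>] 0) (𝓝 0) := by
      refine squeeze_zero_norm' ?_
        (by simpa using hc0lim.mul_const ((d.choose k : ℝ) * Real.sqrt B ^ k))
      filter_upwards [hck_bound k] with s hs
      simpa [Real.norm_eq_abs] using hs
    exact tendsto_nhds_unique (tendsto_bdryCoeff f b e v k) hzero
  exact Polynomial.ext fun k => by rw [hck0, Polynomial.coeff_zero]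

end QuasiConcave

end Literature.AlgebraicGeometry.HyperbolicPolynomials
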